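import Summits.ABC.ABC.Theses.IneffectiveSubspace
import Literature.NumberTheory.DiophantineGeometry.AbcImpliesHall

/-!
# `TowerExponentWindow` (stmt-ABC-1647), line `binomial-xi-d-zero-threefold` — the REFINED dictionary:
# depth inequality with separate coefficients ⟹ Vojta's `D = 0` flat bound, window `A₂ + C₂ < n`

Lead-prover reshaping of stub B (`stub_flatBoundOfDepth`).  The registered dictionary consumes the level-`n` depth
inequality `log d ≤ C·(log max(a₁,c₁) + log max(a₂,c₂) + log rad d) + C'` under the window `3C < n`.  Reading the
bookkeeping with SEPARATE coefficients `log d ≤ A₁·h₁ + A₂·h₂ + C₂·log rad d + C'` (`h₁ = log max(a₁,c₁)` the height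
of the coefficient pair, `h₂ = log max(a₂,c₂)` the height of the `n`-th-power pair) shows what the line really needs:
only `A₂ + C₂ < n`; the coefficient `A₁` is FREE, and (disprover's mutation, Disproof.lean (d)) the sum over the two
applications can be replaced by a maximum.  Since the trivial Liouville bound `d ≤ max(a₁,c₁)·max(a₂,c₂)ⁿ` is
`(A₁, A₂, C₂) = (1, n, 0)`, the lever of the line is precisely "any saving over Liouville in the `h₂`-coefficient of ONE
binomial two-logarithm form at ONE level, all places coupled with weight `log p`".

* `FlatBoundOfDepth3.one_side` — one application of the depth inequality to a solution of `uXⁿ + vYⁿ = wZⁿ`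
  (`(a₁,a₂,c₁,c₂) = (u,X,w,Z)`, `d = Yⁿ`): `n·log Y ≤ A₁·log(uvw) + A₂·log(wZⁿ)/n + C₂·log Y + C'`.
* `stub_flatBoundOfDepth3` — for `0 ≤ A₁, A₂, C₂`, `A₂ + C₂ < n`: the refined depth inequality at level `n` gives
  `wZⁿ ≤ K·(uvw)^κ` with `κ = (n − C₂ + nA₁)/(n − A₂ − C₂)`, `K = exp(((n − C₂)·log 2 + n·C')/(n − A₂ − C₂))`.
Pure bookkeeping over `ℝ` [cite: Vojta2000ABC, §7] (the `D = 0` threefold `uxⁿ + vyⁿ + wzⁿ = 0`); no new definitions.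
-/

-- `Summit.<Summit>.<Problem>` is the mandated summit-side namespace (CONVENTIONS §2); for the
-- single-conjunct summit `ABC` the two coincide, so the duplicate `ABC.ABC` is deliberate.
set_option linter.dupNamespace false

namespace Summit.ABC.ABC.Theorems

open Literature.NumberTheory.DiophantineGeometry (radical_le_of_dvd_pow)

/-- One application of the level-`n` depth inequality (coefficients `A₁, A₂, C₂ ≥ 0`) to a positive solution of
`uXⁿ + vYⁿ = wZⁿ` with `gcd(uXⁿ, vYⁿ) = 1`, at the data `(a₁,a₂,c₁,c₂) = (u, X, w, Z)` and the divisor `d = Yⁿ` of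
`uXⁿ − wZⁿ = −vYⁿ`: `n·log Y ≤ A₁·log(uvw) + A₂·(log(wZⁿ)/n) + C₂·log Y + C'`
(`max(u,w) ≤ uvw`, `max(X,Z)ⁿ ≤ wZⁿ`, `rad(Yⁿ) ≤ Y`). [cite: Vojta2000ABC, §7] -/
theorem FlatBoundOfDepth3.one_side {n : ℕ} (hn : n ≠ 0) {A₁ A₂ C₂ C' : ℝ} (hA₁ : 0 ≤ A₁) (hA₂ : 0 ≤ A₂)
    (hC₂ : 0 ≤ C₂)
    (hD : ∀ a₁ a₂ c₁ c₂ : ℕ, 0 < a₁ → 0 < a₂ → 0 < c₁ → 0 < c₂ → Nat.Coprime (a₁ * a₂) (c₁ * c₂) →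
      a₁ * a₂ ^ n ≠ c₁ * c₂ ^ n → ∀ d : ℕ, 0 < d → (d : ℤ) ∣ ((a₁ * a₂ ^ n : ℕ) : ℤ) - ((c₁ * c₂ ^ n : ℕ) : ℤ) →
      Real.log (d : ℝ) ≤ A₁ * Real.log ((max a₁ c₁ : ℕ) : ℝ) + A₂ * Real.log ((max a₂ c₂ : ℕ) : ℝ) +
        C₂ * Real.log ((UniqueFactorizationMonoid.radical d : ℕ) : ℝ) + C')
    {u v w X Y Z : ℕ} (hu : 0 < u) (hv : 0 < v) (hw : 0 < w) (hX : 0 < X) (hY : 0 < Y) (hZ : 0 < Z)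
    (heq : u * X ^ n + v * Y ^ n = w * Z ^ n) (hcop : Nat.Coprime (u * X ^ n) (v * Y ^ n)) :
    (n : ℝ) * Real.log (Y : ℝ) ≤ A₁ * Real.log ((u * v * w : ℕ) : ℝ) +
      A₂ * (Real.log ((w * Z ^ n : ℕ) : ℝ) / n) + C₂ * Real.log (Y : ℝ) + C' := by
  -- admissibility of the data `(u, X, w, Z)`, `d = Yⁿ`
  have hcop1 : Nat.Coprime (u * X ^ n) (w * Z ^ n) := by
    rw [← heq]; exact Nat.coprime_self_add_right.mpr hcop
  have hcop2 : Nat.Coprime (u * X) (w * Z) :=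
    Nat.Coprime.coprime_dvd_left (mul_dvd_mul_left u (dvd_pow_self X hn))
      (Nat.Coprime.coprime_dvd_right (mul_dvd_mul_left w (dvd_pow_self Z hn)) hcop1)
  have hne : u * X ^ n ≠ w * Z ^ n := by
    have : 0 < v * Y ^ n := by positivity
    omega
  have hdvd : ((Y ^ n : ℕ) : ℤ) ∣ ((u * X ^ n : ℕ) : ℤ) - ((w * Z ^ n : ℕ) : ℤ) := by
    refine ⟨-(v : ℤ), ?_⟩
    have h := congrArg (Nat.cast : ℕ → ℤ) heq
    push_cast at h ⊢
    linear_combination h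
  have hYn : 0 < Y ^ n := by positivity
  have key := hD u X w Z hu hX hw hZ hcop2 hne (Y ^ n) hYn hdvd
  -- the three bounds
  have huR : (0 : ℝ) < u := by exact_mod_cast hu
  have hvR : (0 : ℝ) < v := by exact_mod_cast hv
  have hwR : (0 : ℝ) < w := by exact_mod_cast hw
  have hXR : (0 : ℝ) < X := by exact_mod_cast hX
  have hYR : (0 : ℝ) < Y := by exact_mod_cast hY
  have hZR : (0 : ℝ) < Z := by exact_mod_cast hZ
  have hnR : (0 : ℝ) < n := by exact_mod_cast Nat.pos_of_ne_zero hn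
  have hb1 : Real.log ((max u w : ℕ) : ℝ) ≤ Real.log ((u * v * w : ℕ) : ℝ) := by
    have h1 : max u w ≤ u * v * w := by
      refine max_le ?_ ?_
      · calc u = u * 1 * 1 := by ring
          _ ≤ u * v * w := Nat.mul_le_mul (Nat.mul_le_mul le_rfl hv) hw
      · calc w = 1 * 1 * w := by ring
          _ ≤ u * v * w := Nat.mul_le_mul (Nat.mul_le_mul hu hv) le_rfl
    exact Real.log_le_log (by exact_mod_cast lt_max_of_lt_left hu) (by exact_mod_cast h1)
  have hb2 : Real.log ((max X Z : ℕ) : ℝ) ≤ Real.log ((w * Z ^ n : ℕ) : ℝ) / n := by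
    rw [le_div_iff₀ hnR, mul_comm, ← Real.log_pow]
    have h1 : (max X Z) ^ n ≤ w * Z ^ n := by
      rcases le_total X Z with hle | hle
      · rw [max_eq_right hle]
        exact Nat.le_mul_of_pos_left _ hw
      · rw [max_eq_left hle]
        calc X ^ n = 1 * X ^ n := (one_mul _).symm
          _ ≤ u * X ^ n := Nat.mul_le_mul_right _ hu
          _ ≤ w * Z ^ n := by rw [← heq]; exact Nat.le_add_right _ _
    have h2 : ((max X Z : ℕ) : ℝ) ^ n ≤ ((w * Z ^ n : ℕ) : ℝ) := by exact_mod_cast h1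
    exact Real.log_le_log (by positivity) h2
  have hb3 : Real.log ((UniqueFactorizationMonoid.radical (Y ^ n) : ℕ) : ℝ) ≤ Real.log (Y : ℝ) := by
    have h1 : UniqueFactorizationMonoid.radical (Y ^ n) ≤ Y := radical_le_of_dvd_pow (n := n) hY.ne' dvd_rfl
    exact Real.log_le_log (by exact_mod_cast Nat.radical_pos _) (by exact_mod_cast h1)
  have hlogYn : Real.log (((Y ^ n : ℕ) : ℕ) : ℝ) = n * Real.log (Y : ℝ) := by
    push_cast; rw [Real.log_pow]
  rw [hlogYn] at key
  have e1 := mul_le_mul_of_nonneg_left hb1 hA₁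
  have e2 := mul_le_mul_of_nonneg_left hb2 hA₂
  have e3 := mul_le_mul_of_nonneg_left hb3 hC₂
  linarith

/-- **Refined dictionary** (`D = 0` flat bound from the depth inequality with separate coefficients).  For
`0 ≤ A₁, A₂, C₂` with `A₂ + C₂ < n`: if every positive divisor `d` of `a₁a₂ⁿ − c₁c₂ⁿ` (positive data,
`gcd(a₁a₂, c₁c₂) = 1`, `a₁a₂ⁿ ≠ c₁c₂ⁿ`) satisfies `log d ≤ A₁·log max(a₁,c₁) + A₂·log max(a₂,c₂) + C₂·log rad d + C'`,
then `wZⁿ ≤ K·(uvw)^κ` on positive solutions of `uXⁿ + vYⁿ = wZⁿ` with `gcd(uXⁿ, vYⁿ) = 1`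
(`κ = (n − C₂ + nA₁)/(n − A₂ − C₂)`).  Proof: `one_side` for `Y` and, by symmetry, for `X` gives
`(n − C₂)·M ≤ A₁L + A₂ℓ/n + C'` for `M = max(log X, log Y)`, `L = log(uvw)`, `ℓ = log(wZⁿ)`; and
`wZⁿ ≤ 2·max(uXⁿ, vYⁿ) ≤ 2uvw·e^{nM}` gives `ℓ ≤ log 2 + L + nM`; eliminate `M`. The registered stub
`stub_flatBoundOfDepth` is the case `A₁ = A₂ = C₂ = C` (window `2C < n`, implied by its `3C < n`).
[cite: Vojta2000ABC, §7] -/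
theorem stub_flatBoundOfDepth3 : ∀ n : ℕ, ∀ A₁ A₂ C₂ C' : ℝ, 0 ≤ A₁ → 0 ≤ A₂ → 0 ≤ C₂ → A₂ + C₂ < n → (∀ a₁ a₂ c₁ c₂ : ℕ, 0 < a₁ → 0 < a₂ → 0 < c₁ → 0 < c₂ → Nat.Coprime (a₁ * a₂) (c₁ * c₂) → a₁ * a₂ ^ n ≠ c₁ * c₂ ^ n → ∀ d : ℕ, 0 < d → (d : ℤ) ∣ ((a₁ * a₂ ^ n : ℕ) : ℤ) - ((c₁ * c₂ ^ n : ℕ) : ℤ) → Real.log (d : ℝ) ≤ A₁ * Real.log ((max a₁ c₁ : ℕ) : ℝ) + A₂ * Real.log ((max a₂ c₂ : ℕ) : ℝ) + C₂ * Real.log ((UniqueFactorizationMonoid.radical d : ℕ) : ℝ) + C') → ∃ κ K : ℝ, ∀ u v w X Y Z : ℕ, 0 < u → 0 < v → 0 < w → 0 < X → 0 < Y → 0 < Z → u * X ^ n + v * Y ^ n = w * Z ^ n → Nat.Coprime (u * X ^ n) (v * Y ^ n) → ((w * Z ^ n : ℕ) : ℝ) ≤ K * ((u * v * w : ℕ)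 : ℝ) ^ κ := by
  intro n A₁ A₂ C₂ C' hA₁ hA₂ hC₂ hwin hD
  have hnR0 : (0 : ℝ) < n := by linarith
  have hn : n ≠ 0 := by rintro rfl; simp at hnR0
  set δ : ℝ := (n : ℝ) - A₂ - C₂ with hδ
  have hδ0 : 0 < δ := by rw [hδ]; linarith
  set κ : ℝ := ((n : ℝ) - C₂ + n * A₁) / δ with hκ
  set c₀ : ℝ := (((n : ℝ) - C₂) * Real.log 2 + n * C') / δ with hc₀
  refine ⟨κ, Real.exp c₀, ?_⟩
  intro u v w X Y Z hu hv hw hX hY hZ heq hcop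
  have huR : (0 : ℝ) < u := by exact_mod_cast hu
  have hvR : (0 : ℝ) < v := by exact_mod_cast hv
  have hwR : (0 : ℝ) < w := by exact_mod_cast hw
  have hXR : (0 : ℝ) < X := by exact_mod_cast hX
  have hYR : (0 : ℝ) < Y := by exact_mod_cast hY
  have hZR : (0 : ℝ) < Z := by exact_mod_cast hZ
  set L : ℝ := Real.log ((u * v * w : ℕ) : ℝ) with hL
  set ℓ : ℝ := Real.log ((w * Z ^ n : ℕ) : ℝ) with hℓ
  have hP0 : (0 : ℝ) < ((u * v * w : ℕ) : ℝ) := by positivity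
  have hc0 : (0 : ℝ) < ((w * Z ^ n : ℕ) : ℝ) := by positivity
  -- (1), (2): the two applications
  have hYside := FlatBoundOfDepth3.one_side hn hA₁ hA₂ hC₂ hD hu hv hw hX hY hZ heq hcop
  have hXside : (n : ℝ) * Real.log (X : ℝ) ≤ A₁ * L + A₂ * (ℓ / n) + C₂ * Real.log (X : ℝ) + C' := by
    have h := FlatBoundOfDepth3.one_side hn hA₁ hA₂ hC₂ hD hv hu hw hY hX hZ
      (by rw [← heq]; ring) hcop.symm
    have e : ((v * u * w : ℕ) : ℝ) = ((u * v * w : ℕ) : ℝ) := by push_cast; ring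
    rwa [e] at h
  -- (3): the maximum `M`
  set M : ℝ := max (Real.log (X : ℝ)) (Real.log (Y : ℝ)) with hM
  have hMbound : ((n : ℝ) - C₂) * M ≤ A₁ * L + A₂ * (ℓ / n) + C' := by
    rcases le_total (Real.log (X : ℝ)) (Real.log (Y : ℝ)) with hle | hle
    · rw [hM, max_eq_right hle]; linarith
    · rw [hM, max_eq_left hle]; linarith
  -- (4): `wZⁿ ≤ 2·max(uXⁿ, vYⁿ) ≤ 2·uvw·exp(n M)`
  have hℓbound : ℓ ≤ Real.log 2 + L + n * M := by
    have hXM : Real.log (X : ℝ) ≤ M := le_max_left _ _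
    have hYM : Real.log (Y : ℝ) ≤ M := le_max_right _ _
    have hXe : (X : ℝ) ^ n ≤ Real.exp (n * M) := by
      have : (X : ℝ) ^ n = Real.exp (n * Real.log (X : ℝ)) := by
        rw [← Real.log_pow, Real.exp_log (by positivity)]
      rw [this]; exact Real.exp_le_exp.mpr (by nlinarith [hnR0.le])
    have hYe : (Y : ℝ) ^ n ≤ Real.exp (n * M) := by
      have : (Y : ℝ) ^ n = Real.exp (n * Real.log (Y : ℝ)) := by
        rw [← Real.log_pow, Real.exp_log (by positivity)]
      rw [this]; exact Real.exp_le_exp.mpr (by nlinarith [hnR0.le])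
    have hE : 0 < Real.exp (n * M) := Real.exp_pos _
    have h1 : ((w * Z ^ n : ℕ) : ℝ) ≤ 2 * ((u * v * w : ℕ) : ℝ) * Real.exp (n * M) := by
      have heqR : ((w * Z ^ n : ℕ) : ℝ) = (u : ℝ) * (X : ℝ) ^ n + (v : ℝ) * (Y : ℝ) ^ n := by
        rw [← heq]; push_cast; ring
      rw [heqR]; push_cast
      have hu1 : (1 : ℝ) ≤ u := by exact_mod_cast hu
      have hv1 : (1 : ℝ) ≤ v := by exact_mod_cast hv
      have hw1 : (1 : ℝ) ≤ w := by exact_mod_cast hw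
      have t1 : (u : ℝ) * (X : ℝ) ^ n ≤ (u : ℝ) * v * w * Real.exp (n * M) := by
        calc (u : ℝ) * (X : ℝ) ^ n ≤ (u : ℝ) * Real.exp (n * M) := mul_le_mul_of_nonneg_left hXe huR.le
          _ = (u : ℝ) * 1 * 1 * Real.exp (n * M) := by ring
          _ ≤ (u : ℝ) * v * w * Real.exp (n * M) := by gcongr
      have t2 : (v : ℝ) * (Y : ℝ) ^ n ≤ (u : ℝ) * v * w * Real.exp (n * M) := by
        calc (v : ℝ) * (Y : ℝ) ^ n ≤ (v : ℝ) * Real.exp (n * M) := mul_le_mul_of_nonneg_left hYe hvR.le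
          _ = 1 * (v : ℝ) * 1 * Real.exp (n * M) := by ring
          _ ≤ (u : ℝ) * v * w * Real.exp (n * M) := by gcongr
      linarith
    have h2 := Real.log_le_log hc0 h1
    rw [Real.log_mul (by positivity) hE.ne', Real.log_mul (by norm_num) hP0.ne', Real.log_exp] at h2
    simpa [hℓ, hL] using h2
  -- (5): eliminate `M`: `δ·ℓ ≤ (n − C₂ + nA₁)·L + (n − C₂)·log 2 + n·C'`
  have hnC : 0 ≤ (n : ℝ) - C₂ := by linarith
  have helim : δ * ℓ ≤ ((n : ℝ) - C₂ + n * A₁) * L + ((n : ℝ) - C₂) * Real.log 2 + n * C' := by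
    have h1 := mul_le_mul_of_nonneg_left hℓbound hnC
    have h2 := mul_le_mul_of_nonneg_left hMbound hnR0.le
    have e : (n : ℝ) * (A₁ * L + A₂ * (ℓ / n) + C') = n * A₁ * L + A₂ * ℓ + n * C' := by
      field_simp
    rw [e] at h2
    rw [hδ]
    nlinarith
  have hℓle : ℓ ≤ κ * L + c₀ := by
    rw [hκ, hc₀, div_mul_eq_mul_div, ← add_div, le_div_iff₀ hδ0]
    linarith
  -- (6): exponentiate
  have hlhs : ((w * Z ^ n : ℕ) : ℝ) = Real.exp ℓ := by rw [hℓ, Real.exp_log hc0]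
  have hrhs : Real.exp c₀ * ((u * v * w : ℕ) : ℝ) ^ κ = Real.exp (κ * L + c₀) := by
    rw [Real.rpow_def_of_pos hP0, ← Real.exp_add, hL]; ring_nf
  rw [hlhs, hrhs]
  exact Real.exp_le_exp.mpr hℓle

end Summit.ABC.ABC.Theorems
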